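import Literature.Analysis.FluidPDE.TaoCascadeRescaledStepOrder
import Mathlib.Topology.Order.LeftRightNhds
import Mathlib.Topology.Instances.Real.Lemmas
import Mathlib.Order.Filter.AtTopBot.Basic
import HarnessLib

/-!
# Tao's cascade ODE, Prop. 6.5: bookkeeping of the parameter regime for the proof (§6.5–6.7)

T. Tao, *Finite time blowup for an averaged three-dimensional Navier–Stokes equation*,
J. Amer. Math. Soc. 29 (2016), 601–674 = arXiv:1402.0290v3, §6.4 Prop. 6.5 (equation numbers of
arXiv v3).

The statement being proved bottom-up in the `TaoCascadeRescaled*` / `TaoCascadeZeroScale*` files is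
`TaoCascade.rescaledStepWith' γ` (`TaoCascadeRescaledStepOrder.lean`): Prop. 6.5 with the implied
constant `C₃` of (6.53) fixed before `K₀` is chosen (the order of quantifiers the printed proof of
Prop. 6.13, (6.120)–(6.125), actually uses; see that file's docstring), corrected coefficient
`rescaledStepCorrected'`.

Every intermediate result of §6.5–6.7 ("Let the notation and hypotheses be as in Proposition 6.5
…") is a statement about one datum `(ε₀, K, ε, C₁, C₂, C₃, n₀, N, τ, (a,b,c,d), Ẽ)` obeying
(i)–(ix), valid for `K` large (depending on `ε₀, C₃`), `ε` small (on `ε₀, C₃, K`), `n₀` large (on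
everything): the pointwise lemmas of the sibling files carry explicit largeness hypotheses
(`K ≥ 2`, `10⁸ ≤ ε₀ K⁴`, `C₂ (1+ε₀)^{-n₀/2} · const ≤ 1/100`, …). This file provides the bookkeeping
that turns such pointwise statements into the `∃ K₀ ∀ K ∃ e₀ ∀ ε ∀ C₁ C₂ ∃ N₀ ∀ n₀ …` form and
combines them: `RescaledDatum` bundles the datum, `RescaledDatum.Valid γ` its standing hypotheses,
`InRegime γ P` says "`P` holds for every datum obeying (i)–(ix)_γ in the regime", and
`InRegime.mono/and/of_forall/of_K/of_eps/of_n0/anti` are the calculus of "taking `K` larger, `ε`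
smaller, `n₀` larger"; `rescaledStepWith'_iff_inRegime` identifies Prop. 6.5 (in the form
`rescaledStepWith'`) with `InRegime γ (∃ τ₁ μ₁, RescaledConclusion …)` definitionally, so the final
assembly of Prop. 6.5 is an `InRegime.mono` of the conjunction of its steps. Two folklore
largeness facts feeding `of_n0` / `of_K` close the file.

## References

* T. Tao, J. Amer. Math. Soc. 29 (2016), 601–674 = arXiv:1402.0290v3, §6.4 Prop. 6.5 (the parameter
  conventions "`K` sufficiently large depending on `ε₀` …"), Remark 6.6. [`Tao2016AveragedNS`]
-/

noncomputable section

open Set Filter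
open scoped _root_.Topology

namespace Literature.Analysis.FluidPDE

namespace TaoCascade

/-! ## The datum of Prop. 6.5 and the regime quantifier -/

/-- **A datum of Prop. 6.5**: parameters `ε₀, K, ε`, implied constants `C₁, C₂, C₃`, scales `n₀ ≤ N`,
rescaled checkpoint times `τ`, modes `a_k, b_k, c_k, d_k ↦ Y 0 k, …, Y 3 k` and energies `Ẽ_k ↦ F k`
(the objects "as in Proposition 6.5" that §6.5–6.7 argue about). [cite: Tao2016AveragedNS, §6.4 Prop. 6.5] -/
structure RescaledDatum where
  /-- the dyadic parameter `ε₀` -/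
  ε₀ : ℝ
  /-- the coupling parameter `K` -/
  K : ℝ
  /-- the parameter `ε` -/
  ε : ℝ
  /-- implied constant of (6.45)–(6.48) -/
  C₁ : ℝ
  /-- implied constant of (6.51) -/
  C₂ : ℝ
  /-- implied constant of (6.53) -/
  C₃ : ℝ
  /-- the initial scale `n₀` -/
  n₀ : ℤ
  /-- the current level `N ≥ n₀` -/
  N : ℤ
  /-- rescaled checkpoint times `τ_k` -/
  τ : ℤ → ℝ
  /-- rescaled modes `a_k, b_k, c_k, d_k` -/
  Y : Fin 4 → ℤ → ℝ → ℝ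
  /-- rescaled energies `Ẽ_k` -/
  F : ℤ → ℝ → ℝ

namespace RescaledDatum

/-- **Standing hypotheses of §6.5–6.7 for a datum** ("the notation and hypotheses are as in
Proposition 6.5"): the parameter ranges `0 < ε₀ < 1`, `K > 0`, `ε > 0`, `C₁, C₂, C₃ ≥ 0`, `n₀ ≤ N`, and
hypotheses (i)–(ix) with `X₃`-coefficient `γ(K)`. [cite: Tao2016AveragedNS, §6.4 Prop. 6.5] -/
structure Valid (γ : ℝ → ℝ) (D : RescaledDatum) : Prop where
  /-- `0 < ε₀` -/
  ε₀_pos : 0 < D.ε₀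
  /-- `ε₀ < 1` -/
  ε₀_lt_one : D.ε₀ < 1
  /-- `0 < K` -/
  K_pos : 0 < D.K
  /-- `0 < ε` -/
  ε_pos : 0 < D.ε
  /-- `0 ≤ C₁` -/
  C₁_nonneg : 0 ≤ D.C₁
  /-- `0 ≤ C₂` -/
  C₂_nonneg : 0 ≤ D.C₂
  /-- `0 ≤ C₃` -/
  C₃_nonneg : 0 ≤ D.C₃
  /-- `n₀ ≤ N` -/
  n₀_le_N : D.n₀ ≤ D.N
  /-- hypotheses (i)–(ix) of Prop. 6.5 -/
  hyp : RescaledHypotheses (γ D.K) D.ε₀ D.K D.ε D.C₁ D.C₂ D.C₃ D.n₀ D.N D.τ D.Y D.F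

end RescaledDatum

/-- **"In the regime of Prop. 6.5, every datum obeying (i)–(ix)_γ satisfies `P`"**: for `0 < ε₀ < 1`
and `C₃ ≥ 0`, for `K` large, `ε` small, all `C₁, C₂ ≥ 0`, `n₀` large, `N ≥ n₀` and all `τ, Y, F`
obeying `RescaledHypotheses (γ K) …`, the property `P` of the datum holds. Prop. 6.5 (regime form) is
the case `P = ∃ τ₁ μ₁, RescaledConclusion …` (`rescaledStepWith'_iff_inRegime`); Lemmas 6.7–6.10 and
Props. 6.12–6.17 are other instances. [cite: Tao2016AveragedNS, §6.4 Prop. 6.5] -/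
def InRegime (γ : ℝ → ℝ) (P : RescaledDatum → Prop) : Prop :=
  ∀ ε₀ : ℝ, 0 < ε₀ → ε₀ < 1 → ∀ C₃ : ℝ, 0 ≤ C₃ →
    ∃ K₀ : ℝ, ∀ K : ℝ, K₀ ≤ K → 0 < K →
      ∃ e₀ : ℝ, 0 < e₀ ∧ ∀ ε : ℝ, 0 < ε → ε ≤ e₀ →
        ∀ C₁ C₂ : ℝ, 0 ≤ C₁ → 0 ≤ C₂ →
          ∃ N₀ : ℤ, ∀ n₀ : ℤ, N₀ ≤ n₀ → ∀ N : ℤ, n₀ ≤ N →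
            ∀ (τ : ℤ → ℝ) (Y : Fin 4 → ℤ → ℝ → ℝ) (F : ℤ → ℝ → ℝ),
              RescaledHypotheses (γ K) ε₀ K ε C₁ C₂ C₃ n₀ N τ Y F →
                P ⟨ε₀, K, ε, C₁, C₂, C₃, n₀, N, τ, Y, F⟩

/-- Prop. 6.5 in the form `rescaledStepWith'` (`C₃` before `K₀`) is the `InRegime` statement of its
conclusion (definitionally). [cite: Tao2016AveragedNS, §6.4 Prop. 6.5] -/
theorem rescaledStepWith'_iff_inRegime (γ : ℝ → ℝ) :
    rescaledStepWith' γ ↔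
      InRegime γ fun D => ∃ τ₁ μ₁ : ℝ, RescaledConclusion (γ D.K) D.ε₀ D.K D.ε D.n₀ D.Y D.F τ₁ μ₁ :=
  Iff.rfl

/-- In particular for the corrected coefficient. [cite: Tao2016AveragedNS, §6.4 Prop. 6.5] -/
theorem rescaledStepCorrected'_iff_inRegime :
    rescaledStepCorrected' ↔
      InRegime (fun K => 1 / 10 ^ 5 * Real.exp (-K ^ 10 / 2)) fun D =>
        ∃ τ₁ μ₁ : ℝ, RescaledConclusion (1 / 10 ^ 5 * Real.exp (-D.K ^ 10 / 2)) D.ε₀ D.K D.ε D.n₀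
          D.Y D.F τ₁ μ₁ :=
  Iff.rfl

namespace InRegime

variable {γ : ℝ → ℝ} {P Q : RescaledDatum → Prop}

/-- **Monotonicity**: a pointwise implication valid for every datum obeying the standing hypotheses
transports `InRegime`. [cite: Tao2016AveragedNS, §6.4 Prop. 6.5] -/
theorem mono (hPQ : ∀ D : RescaledDatum, D.Valid γ → P D → Q D) (h : InRegime γ P) :
    InRegime γ Q := by
  intro ε₀ hε₀ hε₀1 C₃ hC₃
  obtain ⟨K₀, hK⟩ := h ε₀ hε₀ hε₀1 C₃ hC₃
  refine ⟨K₀, fun K hK₀K hKpos => ?_⟩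
  obtain ⟨e₀, he₀, hε⟩ := hK K hK₀K hKpos
  refine ⟨e₀, he₀, fun ε hεpos hεle C₁ C₂ hC₁ hC₂ => ?_⟩
  obtain ⟨N₀, hN⟩ := hε ε hεpos hεle C₁ C₂ hC₁ hC₂
  refine ⟨N₀, fun n₀ hn₀ N hN' τ Y F hyp => ?_⟩
  exact hPQ _ ⟨hε₀, hε₀1, hKpos, hεpos, hC₁, hC₂, hC₃, hN', hyp⟩ (hN n₀ hn₀ N hN' τ Y F hyp)

/-- **Conjunction**: two regime statements hold simultaneously in the regime (larger `K₀`, smaller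
`e₀`, larger `N₀`). [cite: Tao2016AveragedNS, §6.4 Prop. 6.5] -/
theorem and (hP : InRegime γ P) (hQ : InRegime γ Q) : InRegime γ fun D => P D ∧ Q D := by
  intro ε₀ hε₀ hε₀1 C₃ hC₃
  obtain ⟨K₁, hK₁⟩ := hP ε₀ hε₀ hε₀1 C₃ hC₃
  obtain ⟨K₂, hK₂⟩ := hQ ε₀ hε₀ hε₀1 C₃ hC₃
  refine ⟨max K₁ K₂, fun K hK hKpos => ?_⟩
  obtain ⟨e₁, he₁, h₁⟩ := hK₁ K ((le_max_left _ _).trans hK) hKpos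
  obtain ⟨e₂, he₂, h₂⟩ := hK₂ K ((le_max_right _ _).trans hK) hKpos
  refine ⟨min e₁ e₂, lt_min he₁ he₂, fun ε hεpos hεle C₁ C₂ hC₁ hC₂ => ?_⟩
  obtain ⟨N₁, hN₁⟩ := h₁ ε hεpos (hεle.trans (min_le_left _ _)) C₁ C₂ hC₁ hC₂
  obtain ⟨N₂, hN₂⟩ := h₂ ε hεpos (hεle.trans (min_le_right _ _)) C₁ C₂ hC₁ hC₂
  refine ⟨max N₁ N₂, fun n₀ hn₀ N hN' τ Y F hyp => ⟨?_, ?_⟩⟩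
  · exact hN₁ n₀ ((le_max_left _ _).trans hn₀) N hN' τ Y F hyp
  · exact hN₂ n₀ ((le_max_right _ _).trans hn₀) N hN' τ Y F hyp

/-- A property of all valid data holds in the regime. [cite: Tao2016AveragedNS, §6.4 Prop. 6.5] -/
theorem of_forall (h : ∀ D : RescaledDatum, D.Valid γ → P D) : InRegime γ P := by
  intro ε₀ hε₀ hε₀1 C₃ hC₃
  refine ⟨0, fun K _ hKpos => ⟨1, one_pos, fun ε hεpos _ C₁ C₂ hC₁ hC₂ => ⟨0, ?_⟩⟩⟩
  intro n₀ _ N hN' τ Y F hyp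
  exact h _ ⟨hε₀, hε₀1, hKpos, hεpos, hC₁, hC₂, hC₃, hN', hyp⟩

/-- **"`K` sufficiently large depending on `ε₀` (and `C₃`)"**: a condition on `K` that holds
eventually at `+∞` for each `ε₀, C₃` holds in the regime. [cite: Tao2016AveragedNS, §6.4 Prop. 6.5] -/
theorem of_K {p : ℝ → ℝ → ℝ → Prop}
    (hp : ∀ ε₀ C₃ : ℝ, 0 < ε₀ → ε₀ < 1 → 0 ≤ C₃ → ∀ᶠ K in atTop, p ε₀ C₃ K) :
    InRegime γ fun D => p D.ε₀ D.C₃ D.K := by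
  intro ε₀ hε₀ hε₀1 C₃ hC₃
  obtain ⟨K₀, hK₀⟩ := eventually_atTop.1 (hp ε₀ C₃ hε₀ hε₀1 hC₃)
  refine ⟨K₀, fun K hK _ => ⟨1, one_pos, fun ε _ _ C₁ C₂ _ _ => ⟨0, ?_⟩⟩⟩
  intro n₀ _ N _ τ Y F _
  exact hK₀ K hK

/-- **"`ε` sufficiently small depending on `ε₀, K` (and `C₃`)"**: a condition on `ε` that holds
eventually at `0⁺` for each `ε₀, C₃, K > 0` holds in the regime. [cite: Tao2016AveragedNS, §6.4 Prop. 6.5] -/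
theorem of_eps {p : ℝ → ℝ → ℝ → ℝ → Prop}
    (hp : ∀ ε₀ C₃ K : ℝ, 0 < ε₀ → ε₀ < 1 → 0 ≤ C₃ → 0 < K →
      ∀ᶠ ε in 𝓝[>] (0 : ℝ), p ε₀ C₃ K ε) :
    InRegime γ fun D => p D.ε₀ D.C₃ D.K D.ε := by
  intro ε₀ hε₀ hε₀1 C₃ hC₃
  refine ⟨0, fun K _ hKpos => ?_⟩
  obtain ⟨e₀, he₀, h⟩ := (nhdsGT_basis_Ioc (0 : ℝ)).eventually_iff.1 (hp ε₀ C₃ K hε₀ hε₀1 hC₃ hKpos)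
  refine ⟨e₀, he₀, fun ε hεpos hεle C₁ C₂ _ _ => ⟨0, ?_⟩⟩
  intro n₀ _ N _ τ Y F _
  exact h ⟨hεpos, hεle⟩

/-- **"`n₀` sufficiently large depending on `ε₀, K, ε` and the implied constants"**: a condition on
`n₀` that holds eventually at `+∞` for all admissible `ε₀, K, ε, C₁, C₂, C₃` holds in the regime.
[cite: Tao2016AveragedNS, §6.4 Prop. 6.5] -/
theorem of_n0 {p : ℝ → ℝ → ℝ → ℝ → ℝ → ℝ → ℤ → Prop}
    (hp : ∀ ε₀ K ε C₁ C₂ C₃ : ℝ, 0 < ε₀ → ε₀ < 1 → 0 < K → 0 < ε → 0 ≤ C₁ → 0 ≤ C₂ → 0 ≤ C₃ →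
      ∀ᶠ n₀ : ℤ in atTop, p ε₀ K ε C₁ C₂ C₃ n₀) :
    InRegime γ fun D => p D.ε₀ D.K D.ε D.C₁ D.C₂ D.C₃ D.n₀ := by
  intro ε₀ hε₀ hε₀1 C₃ hC₃
  refine ⟨0, fun K _ hKpos => ⟨1, one_pos, fun ε hεpos _ C₁ C₂ hC₁ hC₂ => ?_⟩⟩
  obtain ⟨N₀, hN₀⟩ := eventually_atTop.1 (hp ε₀ K ε C₁ C₂ C₃ hε₀ hε₀1 hKpos hεpos hC₁ hC₂ hC₃)
  exact ⟨N₀, fun n₀ hn₀ N _ τ Y F _ => hN₀ n₀ hn₀⟩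

/-- **Weakening the `X₃`-coefficient**: hypothesis (6.56)_γ gets weaker as `γ` grows, so a regime
statement for `γ` implies the same statement for any `γ' ≤ γ` (e.g. corrected ⇒ printed hypotheses).
[cite: Tao2016AveragedNS, §6.4 Prop. 6.5 (6.56)] -/
theorem anti {γ' : ℝ → ℝ} (hγ : ∀ K, 0 < K → γ' K ≤ γ K) (h : InRegime γ P) : InRegime γ' P := by
  intro ε₀ hε₀ hε₀1 C₃ hC₃
  obtain ⟨K₀, hK⟩ := h ε₀ hε₀ hε₀1 C₃ hC₃
  refine ⟨K₀, fun K hK₀K hKpos => ?_⟩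
  obtain ⟨e₀, he₀, hε⟩ := hK K hK₀K hKpos
  refine ⟨e₀, he₀, fun ε hεpos hεle C₁ C₂ hC₁ hC₂ => ?_⟩
  obtain ⟨N₀, hN⟩ := hε ε hεpos hεle C₁ C₂ hC₁ hC₂
  refine ⟨N₀, fun n₀ hn₀ N hN' τ Y F hyp => hN n₀ hn₀ N hN' τ Y F ?_⟩
  have hc : |Y 2 0 0| ≤ γ K * ε ^ 2 :=
    hyp.c_abs_le.trans (mul_le_mul_of_nonneg_right (hγ K hKpos) (sq_nonneg ε))
  exact { hyp with c_abs_le := hc }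

end InRegime

/-! ## Two standard largeness facts used to feed `of_K` / `of_n0` -/

/-- `A (1+ε₀)^{-n₀/2} ≤ δ` for `n₀` large (`ε₀, δ > 0`): the form in which "`n₀` sufficiently large"
makes every viscosity / energy-defect error of §6.5–6.7 negligible (cf. Tao's Remark 6.6).
[folklore] -/
theorem eventually_mul_rpow_neg_half_le {ε₀ : ℝ} (hε₀ : 0 < ε₀) (A : ℝ) {δ : ℝ} (hδ : 0 < δ) :
    ∀ᶠ n₀ : ℤ in atTop, A * (1 + ε₀) ^ (-(n₀ : ℝ) / 2) ≤ δ := by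
  have h1 : (1 : ℝ) < 1 + ε₀ := by linarith
  -- `(1+ε₀)^x → 0` as `x → -∞`, and `-(n₀)/2 → -∞`
  have hlim : Tendsto (fun n₀ : ℤ => A * (1 + ε₀) ^ (-(n₀ : ℝ) / 2)) atTop (𝓝 (A * 0)) := by
    refine Tendsto.const_mul A ?_
    have hbot : Tendsto (fun n₀ : ℤ => -(n₀ : ℝ) / 2) atTop atBot := by
      have : Tendsto (fun n₀ : ℤ => (n₀ : ℝ)) atTop atTop := tendsto_intCast_atTop_atTop
      have h2 : Tendsto (fun x : ℝ => -x / 2) atTop atBot := by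
        have : (fun x : ℝ => -x / 2) = fun x => (-(1 / 2 : ℝ)) * x := by ext x; ring
        rw [this]
        exact (tendsto_const_mul_atBot_of_neg (by norm_num)).2 tendsto_id
      exact h2.comp this
    exact (tendsto_rpow_atBot_of_base_gt_one _ h1).comp hbot
  rw [mul_zero] at hlim
  exact hlim.eventually_le_const hδ

/-- `A / K^p ≤ δ` for `K` large (`p ≥ 1` a natural number, `δ > 0`): the form in which "`K`
sufficiently large" absorbs the `O(K^{-4})`-type corrections of Tao's Lemma 6.10 and §6.7.
[folklore] -/
theorem eventually_div_pow_le (A : ℝ) {p : ℕ} (hp : 1 ≤ p) {δ : ℝ} (hδ : 0 < δ) :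
    ∀ᶠ K : ℝ in atTop, A / K ^ p ≤ δ := by
  have hlim : Tendsto (fun K : ℝ => A / K ^ p) atTop (𝓝 0) := by
    have h := (tendsto_pow_atTop (α := ℝ) (by omega : p ≠ 0)).inv_tendsto_atTop
    have : (fun K : ℝ => A / K ^ p) = fun K => A * (K ^ p)⁻¹ := by ext K; ring
    rw [this]
    simpa using h.const_mul A
  exact hlim.eventually_le_const hδ

end TaoCascade

end Literature.Analysis.FluidPDE
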